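import Literature.Probability.RandomPlanarGeometry.SAWPulledLargeForceExpansionZdThreeSlackTwo
import HarnessLib

/-!
# Axis types of transverse words on `ℤ^{d+1}`: why every fibre census is a polynomial in `d`, and how to compute it

Topic `Literature/Probability/RandomPlanarGeometry` (the generic counting tool behind the fibre censuses of the pulled large-force
expansion [cite: MadrasSlade1993, Definition 1.2.4]; [cite: MadrasSlade1993, §4.2, eq. (4.2.20)–(4.2.22) (p. 94, 2013 reprint)] for the
worked example).

A transverse word is `u : Fin L → Idx d` (`Idx d = Fin d × Bool`: axis and sign).  (1) `sum_twoStepV_eq_zero_iff`: a sum of transverse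
steps vanishes iff every axis is balanced; hence (2) whether any block sum vanishes depends only on the AXIS TYPE of the word (which
positions share an axis, and the signs: `SameType`, `SameType.sum_eq_zero_iff`).  (3) `card_sameType`: the type class of a word with
`k` axes has exactly `d(d−1)⋯(d−k+1)` members in `Word L d` (explicit equivalence with the injections of the axes into `Fin d`).
(4) `canon`: the canonical representative (axes renamed by rank of first occurrence) classifies types (`SameType u u' ↔ canon u = canon u'`).
(5) MASTER FORMULA `card_filter_eq_sum_transversal`: over a transversal `T` of canonical words whose classes exhaust `Word L d`, a
type-invariant count is `Σ_{τ ∈ T} [Q₀ τ] · d^{(k(τ))}` — a polynomial in `d` read off `T`; with `sum_descFactorial_numAxes` and the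
Stirling identities `stirling_four/five/six` for the exhaustion hypothesis.  (6) WORKED EXAMPLE (kernel, `decide +kernel`): the 240
types of length 4 and ★ `card_fiveStepIndex_by_types : #fiveStepIndex d + 24d³ = 16d⁴ + 8d² + 2d` for every `d` — the tree's five-step
count re-derived by types (`card_filter_goodFour` identifies the type-side count with the tree's set).

The definitions `Word`, `SameType`, `IsFirst`, `firsts`, `numAxes`, `firstOcc`, `rank`, `canon`, `sameTypeEquiv`, `tuple4Equiv`, `Box4`,
`ofBox4`, `boxT4`, `T4`, `GoodFour` are this file's tool notions (not notions in print).  No number is taken from print.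

Provenance: lane «pcv-sawmu», a-p3 g18 (2026-08-25); Python twin `axistypes.py` (same counts).
-/

noncomputable section

open Finset
open scoped BigOperators
open Literature.Probability.LatticeModels
open Literature.Probability.RandomPlanarGeometry.SAW

namespace Literature.Probability.RandomPlanarGeometry.SAW.Zd

namespace WordTypes

/-- ★ A sum of transverse steps vanishes iff every axis is balanced: for each axis `x`, as many `+e_x` as `−e_x` among the summands.
[cite: MadrasSlade1993, Definition 1.2.4] -/
theorem sum_twoStepV_eq_zero_iff {d : ℕ} {ι : Type*} (t : Finset ι) (u : ι → Idx d) :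
    ∑ p ∈ t, twoStepV d (u p) = 0 ↔
      ∀ x : Fin d, ((t.filter fun p => u p = (x, true)).card : ℤ) = (t.filter fun p => u p = (x, false)).card := by
  classical
  -- coordinate `x.succ` of the sum is `#plus(x) − #minus(x)`; coordinate `0` is `0`
  have hcoord : ∀ x : Fin d, (∑ p ∈ t, twoStepV d (u p)) x.succ =
      ((t.filter fun p => u p = (x, true)).card : ℤ) - (t.filter fun p => u p = (x, false)).card := by
    intro x
    rw [Finset.sum_apply, Finset.card_filter, Finset.card_filter, Nat.cast_sum, Nat.cast_sum, ← Finset.sum_sub_distrib]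
    refine Finset.sum_congr rfl fun p _ => ?_
    rw [twoStepV_apply_succ, sgnV]
    obtain ⟨a, b⟩ := u p
    by_cases hx : x = a
    · subst hx; cases b <;> simp
    · have h1 : ¬ ((a, b) = (x, true)) := fun h => hx (Prod.mk.inj h).1.symm
      have h2 : ¬ ((a, b) = (x, false)) := fun h => hx (Prod.mk.inj h).1.symm
      simp [hx, h1, h2]
  constructor
  · intro h x
    have := hcoord x
    rw [h, Pi.zero_apply] at this
    linarith
  · intro h
    funext i
    rw [Pi.zero_apply]
    rcases Fin.eq_zero_or_eq_succ i with rfl | ⟨x, rfl⟩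
    · rw [Finset.sum_apply]; exact Finset.sum_eq_zero fun p _ => twoStepV_apply_zero d (u p)
    · rw [hcoord x, h x, sub_self]


/-- Words with the same axis pattern (which positions share an axis) and the same signs have the same vanishing block sums — so the block
conditions of the fibre censuses depend only on the AXIS TYPE of the word, not on `d`. [cite: MadrasSlade1993, Definition 1.2.4] -/
theorem sum_twoStepV_eq_zero_iff_of_sameType {d d' : ℕ} {ι : Type*} (t : Finset ι) (u : ι → Idx d) (u' : ι → Idx d')
    (hax : ∀ p q, (u p).1 = (u q).1 ↔ (u' p).1 = (u' q).1) (hsg : ∀ p, (u p).2 = (u' p).2) :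
    ∑ p ∈ t, twoStepV d (u p) = 0 ↔ ∑ p ∈ t, twoStepV d' (u' p) = 0 := by
  classical
  rw [sum_twoStepV_eq_zero_iff, sum_twoStepV_eq_zero_iff]
  -- counts of `(x, b)` among `u` on `t` = counts of `(x', b)` among `u'` on `t` when `x` and `x'` are the axes of one position
  have key : ∀ p₀, ∀ b : Bool, (t.filter fun p => u p = ((u p₀).1, b)).card = (t.filter fun p => u' p = ((u' p₀).1, b)).card := by
    intro p₀ b
    refine Finset.card_bij (fun p _ => p) (fun p hp => ?_) (fun _ _ _ _ h => h) (fun p hp => ⟨p, ?_, rfl⟩)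
    · rw [Finset.mem_filter] at hp ⊢
      refine ⟨hp.1, Prod.ext ((hax p p₀).1 (by rw [hp.2])) ?_⟩
      rw [← hsg p, hp.2]
    · rw [Finset.mem_filter] at hp ⊢
      refine ⟨hp.1, Prod.ext ((hax p p₀).2 (by rw [hp.2])) ?_⟩
      rw [hsg p, hp.2]
  constructor
  · intro h x'
    by_cases hx : ∃ p₀ ∈ t, (u' p₀).1 = x'
    · obtain ⟨p₀, -, rfl⟩ := hx
      rw [← key p₀ true, ← key p₀ false]
      exact h _
    · push Not at hx
      have e1 : (t.filter fun p => u' p = (x', true)) = ∅ :=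
        Finset.filter_eq_empty_iff.2 fun p hp hEq => hx p hp (by rw [hEq])
      have e2 : (t.filter fun p => u' p = (x', false)) = ∅ :=
        Finset.filter_eq_empty_iff.2 fun p hp hEq => hx p hp (by rw [hEq])
      rw [e1, e2]
  · intro h x
    by_cases hx : ∃ p₀ ∈ t, (u p₀).1 = x
    · obtain ⟨p₀, -, rfl⟩ := hx
      rw [key p₀ true, key p₀ false]
      exact h _
    · push Not at hx
      have e1 : (t.filter fun p => u p = (x, true)) = ∅ :=
        Finset.filter_eq_empty_iff.2 fun p hp hEq => hx p hp (by rw [hEq])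
      have e2 : (t.filter fun p => u p = (x, false)) = ∅ :=
        Finset.filter_eq_empty_iff.2 fun p hp hEq => hx p hp (by rw [hEq])
      rw [e1, e2]


/-! ### Axis types of words and the size of a type class

A word of length `L` is `u : Fin L → Idx d`.  Two words (possibly over different `d`) have the SAME TYPE when the same pairs of
positions share an axis and the signs agree.  The type class of a word with `k` distinct axes has exactly
`d (d-1) ⋯ (d-k+1)` members over `Idx d` — the count behind every "polynomial in `d`" fibre census. -/

/-- Words of length `L` over the transverse alphabet of `ℤ^{d+1}`. [cite: MadrasSlade1993, Definition 1.2.4] -/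
abbrev Word (L d : ℕ) : Type := Fin L → Idx d

/-- Same axis type: the same pairs of positions share an axis, and the signs agree. [cite: MadrasSlade1993, Definition 1.2.4] -/
def SameType {L d d' : ℕ} (u : Word L d) (u' : Word L d') : Prop :=
  (∀ p q : Fin L, (u p).1 = (u q).1 ↔ (u' p).1 = (u' q).1) ∧ ∀ p : Fin L, (u p).2 = (u' p).2

/-- `SameType` is decidable. [cite: MadrasSlade1993, Definition 1.2.4] -/
instance {L d d' : ℕ} (u : Word L d) (u' : Word L d') : Decidable (SameType u u') := by
  unfold SameType; infer_instance

/-- `SameType` is reflexive. [cite: MadrasSlade1993, Definition 1.2.4] -/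
theorem SameType.refl {L d : ℕ} (u : Word L d) : SameType u u := ⟨fun _ _ => Iff.rfl, fun _ => rfl⟩

/-- `SameType` is symmetric. [cite: MadrasSlade1993, Definition 1.2.4] -/
theorem SameType.symm {L d d' : ℕ} {u : Word L d} {u' : Word L d'} (h : SameType u u') : SameType u' u :=
  ⟨fun p q => (h.1 p q).symm, fun p => (h.2 p).symm⟩

/-- `SameType` is transitive. [cite: MadrasSlade1993, Definition 1.2.4] -/
theorem SameType.trans {L d d' d'' : ℕ} {u : Word L d} {u' : Word L d'} {u'' : Word L d''} (h : SameType u u')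
    (h' : SameType u' u'') : SameType u u'' :=
  ⟨fun p q => (h.1 p q).trans (h'.1 p q), fun p => (h.2 p).trans (h'.2 p)⟩

/-- Block sums of same-type words vanish together (restatement of `sum_twoStepV_eq_zero_iff_of_sameType` for `Word`).
[cite: MadrasSlade1993, Definition 1.2.4] -/
theorem SameType.sum_eq_zero_iff {L d d' : ℕ} {u : Word L d} {u' : Word L d'} (h : SameType u u') (t : Finset (Fin L)) :
    ∑ p ∈ t, twoStepV d (u p) = 0 ↔ ∑ p ∈ t, twoStepV d' (u' p) = 0 :=
  sum_twoStepV_eq_zero_iff_of_sameType t u u' h.1 h.2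

/-- Position `p` is the FIRST occurrence of its axis in `u`. [cite: MadrasSlade1993, Definition 1.2.4] -/
def IsFirst {L d : ℕ} (u : Word L d) (p : Fin L) : Prop := ∀ q : Fin L, q < p → (u q).1 ≠ (u p).1

/-- `IsFirst` is decidable. [cite: MadrasSlade1993, Definition 1.2.4] -/
instance {L d : ℕ} (u : Word L d) (p : Fin L) : Decidable (IsFirst u p) := by
  unfold IsFirst; infer_instance

/-- The first-occurrence positions of `u` (one per axis used). [cite: MadrasSlade1993, Definition 1.2.4] -/
def firsts {L d : ℕ} (u : Word L d) : Finset (Fin L) := Finset.univ.filter (IsFirst u)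

/-- Number of distinct axes used by `u` (= number of first occurrences). [cite: MadrasSlade1993, Definition 1.2.4] -/
def numAxes {L d : ℕ} (u : Word L d) : ℕ := (firsts u).card

/-- The first occurrence of the axis of position `p`. [cite: MadrasSlade1993, Definition 1.2.4] -/
def firstOcc {L d : ℕ} (u : Word L d) (p : Fin L) : Fin L :=
  (Finset.univ.filter fun q : Fin L => (u q).1 = (u p).1).min'
    ⟨p, Finset.mem_filter.2 ⟨Finset.mem_univ _, rfl⟩⟩

/-- `firstOcc u p` carries the axis of `p`. [cite: MadrasSlade1993, Definition 1.2.4] -/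
theorem axis_firstOcc {L d : ℕ} (u : Word L d) (p : Fin L) : (u (firstOcc u p)).1 = (u p).1 := by
  have h := Finset.min'_mem (Finset.univ.filter fun q : Fin L => (u q).1 = (u p).1)
    ⟨p, Finset.mem_filter.2 ⟨Finset.mem_univ _, rfl⟩⟩
  exact (Finset.mem_filter.1 h).2

/-- `firstOcc u p ≤ q` for every position `q` on the axis of `p`. [cite: MadrasSlade1993, Definition 1.2.4] -/
theorem firstOcc_le {L d : ℕ} (u : Word L d) {p q : Fin L} (h : (u q).1 = (u p).1) : firstOcc u p ≤ q := by
  unfold firstOcc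
  exact Finset.min'_le _ q (Finset.mem_filter.2 ⟨Finset.mem_univ _, h⟩)

/-- `firstOcc u p` is a first occurrence. [cite: MadrasSlade1993, Definition 1.2.4] -/
theorem isFirst_firstOcc {L d : ℕ} (u : Word L d) (p : Fin L) : IsFirst u (firstOcc u p) := by
  intro q hq hEq
  rw [axis_firstOcc] at hEq
  exact absurd (firstOcc_le u hEq) (not_le.2 hq)

/-- A first occurrence is its own `firstOcc`. [cite: MadrasSlade1993, Definition 1.2.4] -/
theorem firstOcc_eq_self {L d : ℕ} (u : Word L d) {p : Fin L} (hp : IsFirst u p) : firstOcc u p = p := by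
  refine le_antisymm (firstOcc_le u rfl) ?_
  by_contra hlt
  exact hp _ (not_le.1 hlt) (axis_firstOcc u p)

/-- Two first occurrences with the same axis coincide. [cite: MadrasSlade1993, Definition 1.2.4] -/
theorem IsFirst.eq_of_axis_eq {L d : ℕ} {u : Word L d} {p q : Fin L} (hp : IsFirst u p) (hq : IsFirst u q)
    (h : (u p).1 = (u q).1) : p = q := by
  rcases lt_trichotomy p q with hlt | rfl | hgt
  · exact absurd h (hq p hlt)
  · rfl
  · exact absurd h.symm (hp q hgt)

/-- `firstOcc u p = firstOcc u q` iff `p` and `q` share an axis. [cite: MadrasSlade1993, Definition 1.2.4] -/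
theorem firstOcc_eq_firstOcc_iff {L d : ℕ} (u : Word L d) (p q : Fin L) :
    firstOcc u p = firstOcc u q ↔ (u p).1 = (u q).1 := by
  constructor
  · intro h
    rw [← axis_firstOcc u p, ← axis_firstOcc u q, h]
  · intro h
    exact (isFirst_firstOcc u p).eq_of_axis_eq (isFirst_firstOcc u q) (by rw [axis_firstOcc, axis_firstOcc, h])

/-- Same-type words have the same first occurrences. [cite: MadrasSlade1993, Definition 1.2.4] -/
theorem SameType.isFirst_iff {L d d' : ℕ} {u : Word L d} {u' : Word L d'} (h : SameType u u') (p : Fin L) :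
    IsFirst u p ↔ IsFirst u' p := by
  unfold IsFirst
  exact forall_congr' fun q => imp_congr_right fun _ => not_congr (h.1 q p)

/-- Same-type words use the same number of axes. [cite: MadrasSlade1993, Definition 1.2.4] -/
theorem SameType.numAxes_eq {L d d' : ℕ} {u : Word L d} {u' : Word L d'} (h : SameType u u') : numAxes u = numAxes u' := by
  unfold numAxes firsts
  exact congrArg Finset.card (Finset.filter_congr fun p _ => h.isFirst_iff p)

/-- The type class of `u₀` inside `Word L d` is in bijection with the injections of the axes of `u₀` into `Fin d`.
[cite: MadrasSlade1993, Definition 1.2.4] -/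
def sameTypeEquiv {L D : ℕ} (u₀ : Word L D) (d : ℕ) :
    {u : Word L d // SameType u u₀} ≃ ((firsts u₀) ↪ Fin d) where
  toFun u :=
    ⟨fun p => (u.1 p.1).1, fun p q hpq => by
      have hp := (Finset.mem_filter.1 p.2).2
      have hq := (Finset.mem_filter.1 q.2).2
      exact Subtype.ext (hp.eq_of_axis_eq hq ((u.2.1 p.1 q.1).1 hpq))⟩
  invFun e :=
    ⟨fun p => (e ⟨firstOcc u₀ p, Finset.mem_filter.2 ⟨Finset.mem_univ _, isFirst_firstOcc u₀ p⟩⟩, (u₀ p).2),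
      ⟨fun p q => by
        rw [e.injective.eq_iff, Subtype.mk.injEq, firstOcc_eq_firstOcc_iff], fun _ => rfl⟩⟩
  left_inv u := by
    apply Subtype.ext
    funext p
    refine Prod.ext ?_ (u.2.2 p).symm
    -- the axis of `u` at `firstOcc u₀ p` is the axis of `u` at `p`
    exact (u.2.1 _ _).2 (axis_firstOcc u₀ p)
  right_inv e := by
    ext p
    have hp := (Finset.mem_filter.1 p.2).2
    have hfo : (⟨firstOcc u₀ p.1, Finset.mem_filter.2 ⟨Finset.mem_univ _, isFirst_firstOcc u₀ p.1⟩⟩ : firsts u₀) = p :=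
      Subtype.ext (firstOcc_eq_self u₀ hp)
    simp only [Function.Embedding.coeFn_mk]
    rw [hfo]

/-- ★ SIZE OF A TYPE CLASS: the words of `Word L d` with the type of `u₀` number `d (d-1) ⋯ (d-k+1)`, `k` = number of axes of
`u₀` (zero when `d < k`). [cite: MadrasSlade1993, Definition 1.2.4] -/
theorem card_sameType {L D : ℕ} (u₀ : Word L D) (d : ℕ) :
    Fintype.card {u : Word L d // SameType u u₀} = d.descFactorial (numAxes u₀) := by
  rw [Fintype.card_congr (sameTypeEquiv u₀ d), Fintype.card_embedding_eq, Fintype.card_coe, Fintype.card_fin]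
  rfl

/-- The same count as a `Finset.filter` cardinality. [cite: MadrasSlade1993, Definition 1.2.4] -/
theorem card_filter_sameType {L D : ℕ} (u₀ : Word L D) (d : ℕ) :
    (Finset.univ.filter fun u : Word L d => SameType u u₀).card = d.descFactorial (numAxes u₀) := by
  rw [← card_sameType u₀ d, Fintype.card_subtype]


/-! ### The canonical representative of a type -/

/-- Rank of the axis of position `p`: the number of first occurrences before the first occurrence of that axis.
[cite: MadrasSlade1993, Definition 1.2.4] -/
def rank {L d : ℕ} (u : Word L d) (p : Fin L) : ℕ := ((firsts u).filter fun q => q < firstOcc u p).card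

/-- `rank u p < L`. [cite: MadrasSlade1993, Definition 1.2.4] -/
theorem rank_lt {L d : ℕ} (u : Word L d) (p : Fin L) : rank u p < L := by
  unfold rank
  calc ((firsts u).filter fun q => q < firstOcc u p).card
      < (firsts u).card := by
        apply Finset.card_lt_card
        refine Finset.filter_ssubset.2 ⟨firstOcc u p, ?_, lt_irrefl _⟩
        exact Finset.mem_filter.2 ⟨Finset.mem_univ _, isFirst_firstOcc u p⟩
    _ ≤ Fintype.card (Fin L) := Finset.card_le_univ _
    _ = L := Fintype.card_fin L

/-- Equal ranks iff equal axes. [cite: MadrasSlade1993, Definition 1.2.4] -/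
theorem rank_eq_rank_iff {L d : ℕ} (u : Word L d) (p q : Fin L) : rank u p = rank u q ↔ (u p).1 = (u q).1 := by
  constructor
  · intro h
    rw [← firstOcc_eq_firstOcc_iff]
    -- `f ↦ #{first occurrences < f}` is strictly monotone on first occurrences
    have mono : ∀ p q : Fin L, firstOcc u p < firstOcc u q → rank u p < rank u q := by
      intro p q hlt
      unfold rank
      apply Finset.card_lt_card
      have hsub : ((firsts u).filter fun r => r < firstOcc u p) ⊆ (firsts u).filter fun r => r < firstOcc u q :=
        fun x hx => Finset.mem_filter.2 ⟨(Finset.mem_filter.1 hx).1, lt_trans (Finset.mem_filter.1 hx).2 hlt⟩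
      refine (Finset.ssubset_iff_of_subset hsub).2 ⟨firstOcc u p, ?_, ?_⟩
      · exact Finset.mem_filter.2 ⟨Finset.mem_filter.2 ⟨Finset.mem_univ _, isFirst_firstOcc u p⟩, hlt⟩
      · rw [Finset.mem_filter]
        exact fun hm => lt_irrefl _ hm.2
    rcases lt_trichotomy (firstOcc u p) (firstOcc u q) with hlt | heq | hgt
    · exact absurd h (ne_of_lt (mono p q hlt))
    · exact heq
    · exact absurd h (ne_of_gt (mono q p hgt))
  · intro h
    unfold rank
    rw [(firstOcc_eq_firstOcc_iff u p q).2 h]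

/-- The canonical representative of the type of `u`: axes renamed by rank of first occurrence, signs kept; it lives in `Word L L`.
[cite: MadrasSlade1993, Definition 1.2.4] -/
def canon {L d : ℕ} (u : Word L d) : Word L L := fun p => (⟨rank u p, rank_lt u p⟩, (u p).2)

/-- `u` has the type of its canonical representative. [cite: MadrasSlade1993, Definition 1.2.4] -/
theorem sameType_canon {L d : ℕ} (u : Word L d) : SameType u (canon u) := by
  refine ⟨fun p q => ?_, fun p => rfl⟩
  change (u p).1 = (u q).1 ↔ (⟨rank u p, rank_lt u p⟩ : Fin L) = ⟨rank u q, rank_lt u q⟩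
  exact ⟨fun h => Fin.ext ((rank_eq_rank_iff u p q).2 h), fun h => (rank_eq_rank_iff u p q).1 (Fin.mk.inj_iff.1 h)⟩

/-- Same-type words have the same first occurrences of corresponding positions. [cite: MadrasSlade1993, Definition 1.2.4] -/
theorem SameType.firstOcc_eq {L d d' : ℕ} {u : Word L d} {u' : Word L d'} (h : SameType u u') (p : Fin L) :
    firstOcc u p = firstOcc u' p := by
  unfold firstOcc
  congr 1
  exact Finset.filter_congr fun q _ => h.1 q p

/-- Same-type words have the same ranks. [cite: MadrasSlade1993, Definition 1.2.4] -/
theorem SameType.rank_eq {L d d' : ℕ} {u : Word L d} {u' : Word L d'} (h : SameType u u') (p : Fin L) : rank u p = rank u' p := by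
  unfold rank
  have hf : firsts u = firsts u' := Finset.filter_congr fun q _ => h.isFirst_iff q
  rw [hf, h.firstOcc_eq p]

/-- ★ Same-type words have the same canonical representative (so `canon` classifies types). [cite: MadrasSlade1993, Definition 1.2.4] -/
theorem SameType.canon_eq {L d d' : ℕ} {u : Word L d} {u' : Word L d'} (h : SameType u u') : canon u = canon u' := by
  funext p
  refine Prod.ext (Fin.ext (h.rank_eq p)) (h.2 p)

/-- Conversely, words with the same canonical representative have the same type. [cite: MadrasSlade1993, Definition 1.2.4] -/
theorem sameType_of_canon_eq {L d d' : ℕ} {u : Word L d} {u' : Word L d'} (h : canon u = canon u') : SameType u u' :=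
  (sameType_canon u).trans (h ▸ (sameType_canon u').symm)

/-- `numAxes` is read off the canonical representative. [cite: MadrasSlade1993, Definition 1.2.4] -/
theorem numAxes_canon {L d : ℕ} (u : Word L d) : numAxes (canon u) = numAxes u := (sameType_canon u).numAxes_eq.symm


/-! ### The master counting formula over a transversal of types -/

/-- `Word L d` has `(2d)^L` elements. [cite: MadrasSlade1993, Definition 1.2.4] -/
theorem card_word (L d : ℕ) : Fintype.card (Word L d) = (2 * d) ^ L := by
  rw [Fintype.card_fun, Fintype.card_prod, Fintype.card_fin, Fintype.card_bool, Fintype.card_fin, mul_comm]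

/-- ★ MASTER FORMULA.  Let `T` be a set of canonical words of length `L` whose type classes have total size `(2d)^L` (so they exhaust
`Word L d`).  Then a type-invariant count over `Word L d` is the finite sum `Σ_{τ ∈ T} [Q₀ τ] · d(d-1)⋯(d-k(τ)+1)` — a polynomial in `d`
read off the transversal. [cite: MadrasSlade1993, Definition 1.2.4] -/
theorem card_filter_eq_sum_transversal {L d : ℕ} (T : Finset (Word L L)) (hcanon : ∀ τ ∈ T, canon τ = τ)
    (hcount : ∑ τ ∈ T, d.descFactorial (numAxes τ) = (2 * d) ^ L)
    (Q : Word L d → Prop) [DecidablePred Q] (Q₀ : Word L L → Prop) [DecidablePred Q₀]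
    (hQ : ∀ u : Word L d, Q u ↔ Q₀ (canon u)) :
    (Finset.univ.filter Q).card = ∑ τ ∈ T, if Q₀ τ then d.descFactorial (numAxes τ) else 0 := by
  classical
  -- the type classes
  set C : Word L L → Finset (Word L d) := fun τ => Finset.univ.filter fun u => SameType u τ with hC
  have hdisj : (T : Set (Word L L)).PairwiseDisjoint C := by
    intro τ hτ τ' hτ' hne
    refine Finset.disjoint_left.2 fun u hu hu' => hne ?_
    have h1 : SameType u τ := (Finset.mem_filter.1 hu).2
    have h2 : SameType u τ' := (Finset.mem_filter.1 hu').2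
    rw [← hcanon τ hτ, ← hcanon τ' hτ']
    exact (h1.symm.trans h2).canon_eq
  have hcardC : ∀ τ, (C τ).card = d.descFactorial (numAxes τ) := fun τ => card_filter_sameType τ d
  -- they exhaust `Word L d`
  have hunion : T.biUnion C = Finset.univ := by
    apply Finset.eq_univ_of_card
    rw [Finset.card_biUnion hdisj, card_word]
    simpa only [hcardC] using hcount
  -- split the count along the classes
  have hsplit : Finset.univ.filter Q = T.biUnion fun τ => (C τ).filter Q := by
    rw [← Finset.filter_biUnion, hunion]
  have hdisj' : (T : Set (Word L L)).PairwiseDisjoint fun τ => (C τ).filter Q := by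
    intro τ hτ τ' hτ' hne
    exact Finset.disjoint_filter_filter ((hdisj hτ hτ' hne))
  rw [hsplit, Finset.card_biUnion hdisj']
  refine Finset.sum_congr rfl fun τ hτ => ?_
  -- on the class of `τ`, `Q` is constantly `Q₀ τ`
  have hconst : ∀ u ∈ C τ, (Q u ↔ Q₀ τ) := by
    intro u hu
    have h1 : SameType u τ := (Finset.mem_filter.1 hu).2
    rw [hQ u, h1.canon_eq, hcanon τ hτ]
  by_cases h0 : Q₀ τ
  · rw [if_pos h0, ← hcardC τ]
    congr 1
    exact Finset.filter_true_of_mem fun u hu => (hconst u hu).2 h0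
  · rw [if_neg h0, Finset.card_eq_zero]
    exact Finset.filter_false_of_mem fun u hu hq => h0 ((hconst u hu).1 hq)


/-! ### Tools for the total-size hypothesis: grouping by number of axes, and the Stirling identities at lengths 4, 5, 6 -/

/-- A word of length `L` uses at most `L` axes. [cite: MadrasSlade1993, Definition 1.2.4] -/
theorem numAxes_le {L d : ℕ} (u : Word L d) : numAxes u ≤ L := by
  unfold numAxes firsts
  exact (Finset.card_le_univ _).trans (Fintype.card_fin L).le

/-- Grouping the class sizes by the number of axes: `Σ_{τ ∈ T} d^{(k(τ))} = Σ_{k ≤ L} #{τ ∈ T : k(τ) = k} · d^{(k)}`.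
[cite: MadrasSlade1993, Definition 1.2.4] -/
theorem sum_descFactorial_numAxes {L d : ℕ} (T : Finset (Word L L)) :
    ∑ τ ∈ T, d.descFactorial (numAxes τ) =
      ∑ k ∈ Finset.range (L + 1), (T.filter fun τ => numAxes τ = k).card * d.descFactorial k := by
  classical
  rw [← Finset.sum_fiberwise_of_maps_to (s := T) (t := Finset.range (L + 1)) (g := fun τ => numAxes τ)
    (fun τ _ => Finset.mem_range.2 (Nat.lt_succ_of_le (numAxes_le τ)))]
  refine Finset.sum_congr rfl fun k _ => ?_
  rw [Finset.sum_congr rfl fun τ hτ => by rw [(Finset.mem_filter.1 hτ).2], Finset.sum_const, smul_eq_mul]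

/-- Stirling identity at length 4: `d + 7d^{(2)} + 6d^{(3)} + d^{(4)} = d⁴`. [cite: MadrasSlade1993, Definition 1.2.4] -/
theorem stirling_four (d : ℕ) :
    d.descFactorial 1 + 7 * d.descFactorial 2 + 6 * d.descFactorial 3 + d.descFactorial 4 = d ^ 4 := by
  rcases Nat.lt_or_ge d 4 with h | h
  · interval_cases d <;> decide
  · obtain ⟨e, rfl⟩ := Nat.exists_eq_add_of_le' h
    simp only [Nat.descFactorial_succ, Nat.descFactorial_zero, Nat.sub_zero]
    rw [show e + 4 - 1 = e + 3 by omega, show e + 4 - 2 = e + 2 by omega, show e + 4 - 3 = e + 1 by omega]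
    ring

/-- Stirling identity at length 5: `d + 15d^{(2)} + 25d^{(3)} + 10d^{(4)} + d^{(5)} = d⁵`. [cite: MadrasSlade1993, Definition 1.2.4] -/
theorem stirling_five (d : ℕ) :
    d.descFactorial 1 + 15 * d.descFactorial 2 + 25 * d.descFactorial 3 + 10 * d.descFactorial 4 + d.descFactorial 5 = d ^ 5 := by
  rcases Nat.lt_or_ge d 5 with h | h
  · interval_cases d <;> decide
  · obtain ⟨e, rfl⟩ := Nat.exists_eq_add_of_le' h
    simp only [Nat.descFactorial_succ, Nat.descFactorial_zero, Nat.sub_zero]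
    rw [show e + 5 - 1 = e + 4 by omega, show e + 5 - 2 = e + 3 by omega, show e + 5 - 3 = e + 2 by omega,
      show e + 5 - 4 = e + 1 by omega]
    ring

/-- Stirling identity at length 6: `d + 31d^{(2)} + 90d^{(3)} + 65d^{(4)} + 15d^{(5)} + d^{(6)} = d⁶`. [cite: MadrasSlade1993, Definition 1.2.4] -/
theorem stirling_six (d : ℕ) :
    d.descFactorial 1 + 31 * d.descFactorial 2 + 90 * d.descFactorial 3 + 65 * d.descFactorial 4 + 15 * d.descFactorial 5 +
      d.descFactorial 6 = d ^ 6 := by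
  rcases Nat.lt_or_ge d 6 with h | h
  · interval_cases d <;> decide
  · obtain ⟨e, rfl⟩ := Nat.exists_eq_add_of_le' h
    simp only [Nat.descFactorial_succ, Nat.descFactorial_zero, Nat.sub_zero]
    rw [show e + 6 - 1 = e + 5 by omega, show e + 6 - 2 = e + 4 by omega, show e + 6 - 3 = e + 3 by omega,
      show e + 6 - 4 = e + 2 by omega, show e + 6 - 5 = e + 1 by omega]
    ring


/-- Restricting the transversal sum to `Q₀`: `Σ_{τ ∈ T} [Q₀ τ] d^{(k(τ))} = Σ_{k ≤ L} #{τ ∈ T : Q₀ τ ∧ k(τ) = k} · d^{(k)}`.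
[cite: MadrasSlade1993, Definition 1.2.4] -/
theorem sum_ite_descFactorial_numAxes {L d : ℕ} (T : Finset (Word L L)) (Q₀ : Word L L → Prop) [DecidablePred Q₀] :
    ∑ τ ∈ T, (if Q₀ τ then d.descFactorial (numAxes τ) else 0) =
      ∑ k ∈ Finset.range (L + 1), ((T.filter Q₀).filter fun τ => numAxes τ = k).card * d.descFactorial k := by
  rw [← Finset.sum_filter, sum_descFactorial_numAxes]

/-! ### Worked example at length 4: the explicit transversal, and the four-step count `16d⁴ − 24d³ + 8d² + 2d` re-derived by types

The transversal is the set of the 240 canonical words of length 4 (15 set partitions × 16 sign vectors), cut out of a 384-word box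
(`Box4`, letters of axis `≤ position`) by `canon τ = τ`; `decide +kernel` certifies the class counts by number of axes (16, 112, 96, 16), the Stirling identity gives the total `(2d)⁴`, and the master formula then evaluates the number of
words `(a,b,c,e)` with `a+b, b+c, c+e, a+b+c+e ≠ 0` — the transverse words of the five-step irreducible bridges — for every `d`. -/

/-- Transport of a `univ.filter` count along an equivalence (used to run `decide` on tuples rather than on functions).
[cite: MadrasSlade1993, Definition 1.2.4] -/
theorem card_filter_univ_equiv {α β : Type*} [Fintype α] [Fintype β] [DecidableEq β] (e : α ≃ β) (P : β → Prop)
    [DecidablePred P] : (Finset.univ.filter P).card = (Finset.univ.filter fun a => P (e a)).card := by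
  rw [← Finset.map_univ_equiv e, Finset.filter_map, Finset.card_map]
  rfl

/-- Length-4 words as 4-tuples (the tree's encoding of `fiveStepIndex`).
[cite: MadrasSlade1993, Definition 1.2.4] -/
def tuple4Equiv (d : ℕ) : Idx d × Idx d × Idx d × Idx d ≃ Word 4 d where
  toFun t := ![t.1, t.2.1, t.2.2.1, t.2.2.2]
  invFun w := (w 0, w 1, w 2, w 3)
  left_inv t := by rfl
  right_inv w := by
    funext p
    fin_cases p <;> rfl

/-- The `decide`-friendly parametrisation of the canonical words of length 4: tuples whose letter at position `i` has axis `≤ i`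
(a 384-element type). [cite: MadrasSlade1993, Definition 1.2.4] -/
abbrev Box4 : Type := (Fin 1 × Bool) × (Fin 2 × Bool) × (Fin 3 × Bool) × (Fin 4 × Bool)

/-- The word of a box tuple. [cite: MadrasSlade1993, Definition 1.2.4] -/
def ofBox4 (t : Box4) : Word 4 4 :=
  ![(Fin.castLE (by omega) t.1.1, t.1.2), (Fin.castLE (by omega) t.2.1.1, t.2.1.2), (Fin.castLE (by omega) t.2.2.1.1, t.2.2.1.2), t.2.2.2]

/-- `ofBox4` is injective. [cite: MadrasSlade1993, Definition 1.2.4] -/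
theorem ofBox4_injective : Function.Injective ofBox4 := by
  intro t t' h
  have h0 := congrFun h 0
  have h1 := congrFun h 1
  have h2 := congrFun h 2
  have h3 := congrFun h 3
  simp only [ofBox4, Matrix.cons_val_zero, Matrix.cons_val_one, Matrix.cons_val, Prod.mk.injEq,
    Fin.castLE_inj] at h0 h1 h2 h3
  obtain ⟨⟨a0, b0⟩, ⟨a1, b1⟩, ⟨a2, b2⟩, ⟨a3, b3⟩⟩ := t
  obtain ⟨⟨a0', b0'⟩, ⟨a1', b1'⟩, ⟨a2', b2'⟩, ⟨a3', b3'⟩⟩ := t'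
  simp only at h0 h1 h2 h3
  obtain ⟨rfl, rfl⟩ := h0
  obtain ⟨rfl, rfl⟩ := h1
  obtain ⟨rfl, rfl⟩ := h2
  obtain ⟨rfl, rfl⟩ := h3
  rfl

/-- The box tuples whose word is canonical (restricted-growth axis sequence), as a decidable filter. [cite: MadrasSlade1993, Definition 1.2.4] -/
def boxT4 : Finset Box4 := Finset.univ.filter fun t => canon (ofBox4 t) = ofBox4 t

/-- The transversal: the 240 canonical words of length 4 (15 set partitions × 16 sign vectors), as the image of `boxT4` under the
embedding `ofBox4`. [cite: MadrasSlade1993, Definition 1.2.4] -/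
def T4 : Finset (Word 4 4) := boxT4.map ⟨ofBox4, ofBox4_injective⟩

/-- Counting inside `T4` = counting box tuples. [cite: MadrasSlade1993, Definition 1.2.4] -/
theorem card_filter_T4 (P : Word 4 4 → Prop) [DecidablePred P] :
    (T4.filter P).card = (boxT4.filter fun t => P (ofBox4 t)).card := by
  rw [T4, Finset.filter_map, Finset.card_map]
  rfl

/-- `T4` has 240 elements. [cite: MadrasSlade1993, Definition 1.2.4] -/
theorem card_T4 : T4.card = 240 := by
  rw [T4, Finset.card_map]; decide +kernel

/-- Every word of `T4` is canonical. [cite: MadrasSlade1993, Definition 1.2.4] -/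
theorem canon_T4 : ∀ τ ∈ T4, canon τ = τ := by
  intro τ hτ
  obtain ⟨t, ht, rfl⟩ := Finset.mem_map.1 hτ
  exact (Finset.mem_filter.1 ht).2

/-- No word of `T4` has zero axes. [cite: MadrasSlade1993, Definition 1.2.4] -/
theorem card_T4_numAxes_zero : (T4.filter fun τ => numAxes τ = 0).card = 0 := by
  rw [card_filter_T4]; decide +kernel

/-- 16 words of `T4` have one axis. [cite: MadrasSlade1993, Definition 1.2.4] -/
theorem card_T4_numAxes_one : (T4.filter fun τ => numAxes τ = 1).card = 16 := by
  rw [card_filter_T4]; decide +kernel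

/-- 112 words of `T4` have two axes. [cite: MadrasSlade1993, Definition 1.2.4] -/
theorem card_T4_numAxes_two : (T4.filter fun τ => numAxes τ = 2).card = 112 := by
  rw [card_filter_T4]; decide +kernel

/-- 96 words of `T4` have three axes. [cite: MadrasSlade1993, Definition 1.2.4] -/
theorem card_T4_numAxes_three : (T4.filter fun τ => numAxes τ = 3).card = 96 := by
  rw [card_filter_T4]; decide +kernel

/-- 16 words of `T4` have four axes. [cite: MadrasSlade1993, Definition 1.2.4] -/
theorem card_T4_numAxes_four : (T4.filter fun τ => numAxes τ = 4).card = 16 := by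
  rw [card_filter_T4]; decide +kernel

/-- The classes of `T4` exhaust `Word 4 d`: total size `(2d)⁴`. [cite: MadrasSlade1993, Definition 1.2.4] -/
theorem count_T4 (d : ℕ) : ∑ τ ∈ T4, d.descFactorial (numAxes τ) = (2 * d) ^ 4 := by
  rw [sum_descFactorial_numAxes]
  simp only [Finset.sum_range_succ, Finset.sum_range_zero, card_T4_numAxes_zero, card_T4_numAxes_one, card_T4_numAxes_two,
    card_T4_numAxes_three, card_T4_numAxes_four]
  have := stirling_four d
  ring_nf at this ⊢
  omega

/-- The four-letter block condition of the five-step bridges: `a+b, b+c, c+e, a+b+c+e ≠ 0`. [cite: MadrasSlade1993, Definition 1.2.4] -/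
def GoodFour {d : ℕ} (u : Word 4 d) : Prop :=
  ∑ p ∈ ({0, 1} : Finset (Fin 4)), twoStepV d (u p) ≠ 0 ∧ ∑ p ∈ ({1, 2} : Finset (Fin 4)), twoStepV d (u p) ≠ 0 ∧
    ∑ p ∈ ({2, 3} : Finset (Fin 4)), twoStepV d (u p) ≠ 0 ∧ ∑ p ∈ (Finset.univ : Finset (Fin 4)), twoStepV d (u p) ≠ 0

/-- `GoodFour` is decidable. [cite: MadrasSlade1993, Definition 1.2.4] -/
instance {d : ℕ} : DecidablePred (GoodFour (d := d)) := by
  intro u; unfold GoodFour; infer_instance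

/-- `GoodFour` is a type invariant. [cite: MadrasSlade1993, Definition 1.2.4] -/
theorem goodFour_iff_canon {d : ℕ} (u : Word 4 d) : GoodFour u ↔ GoodFour (canon u) := by
  have h := sameType_canon u
  unfold GoodFour
  exact Iff.and (not_congr (h.sum_eq_zero_iff _)) (Iff.and (not_congr (h.sum_eq_zero_iff _))
    (Iff.and (not_congr (h.sum_eq_zero_iff _)) (not_congr (h.sum_eq_zero_iff _))))

/-- No `GoodFour` word of `T4` has zero axes. [cite: MadrasSlade1993, Definition 1.2.4] -/
theorem card_T4_good_zero : ((T4.filter GoodFour).filter fun τ => numAxes τ = 0).card = 0 := by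
  rw [Finset.filter_filter, card_filter_T4]; decide +kernel

/-- 2 `GoodFour` words of `T4` have one axis. [cite: MadrasSlade1993, Definition 1.2.4] -/
theorem card_T4_good_one : ((T4.filter GoodFour).filter fun τ => numAxes τ = 1).card = 2 := by
  rw [Finset.filter_filter, card_filter_T4]; decide +kernel

/-- 48 `GoodFour` words of `T4` have two axes. [cite: MadrasSlade1993, Definition 1.2.4] -/
theorem card_T4_good_two : ((T4.filter GoodFour).filter fun τ => numAxes τ = 2).card = 48 := by
  rw [Finset.filter_filter, card_filter_T4]; decide +kernel

/-- 72 `GoodFour` words of `T4` have three axes. [cite: MadrasSlade1993, Definition 1.2.4] -/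
theorem card_T4_good_three : ((T4.filter GoodFour).filter fun τ => numAxes τ = 3).card = 72 := by
  rw [Finset.filter_filter, card_filter_T4]; decide +kernel

/-- 16 `GoodFour` words of `T4` have four axes. [cite: MadrasSlade1993, Definition 1.2.4] -/
theorem card_T4_good_four : ((T4.filter GoodFour).filter fun τ => numAxes τ = 4).card = 16 := by
  rw [Finset.filter_filter, card_filter_T4]; decide +kernel

/-- ★ EXAMPLE OF THE METHOD: the number of words `(a,b,c,e)` over `Idx d` with `a+b, b+c, c+e, a+b+c+e ≠ 0` is
`2d + 48d(d-1) + 72d(d-1)(d-2) + 16d(d-1)(d-2)(d-3) = 16d⁴ − 24d³ + 8d² + 2d` for every `d` (the five-step irreducible-bridge count,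
tree `card_fiveStepIndex`, re-derived by axis types). [cite: MadrasSlade1993, Definition 1.2.4] -/
theorem card_goodFour (d : ℕ) :
    (Finset.univ.filter fun u : Word 4 d => GoodFour u).card + 24 * d ^ 3 = 16 * d ^ 4 + 8 * d ^ 2 + 2 * d := by
  rw [card_filter_eq_sum_transversal T4 canon_T4 (count_T4 d) GoodFour GoodFour goodFour_iff_canon,
    sum_ite_descFactorial_numAxes]
  simp only [Finset.sum_range_succ, Finset.sum_range_zero, card_T4_good_zero, card_T4_good_one, card_T4_good_two,
    card_T4_good_three, card_T4_good_four]
  rcases Nat.lt_or_ge d 4 with h | h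
  · interval_cases d <;> decide
  · obtain ⟨e, rfl⟩ := Nat.exists_eq_add_of_le' h
    simp only [Nat.descFactorial_succ, Nat.descFactorial_zero, Nat.sub_zero]
    rw [show e + 4 - 1 = e + 3 by omega, show e + 4 - 2 = e + 2 by omega, show e + 4 - 3 = e + 1 by omega]
    ring


/-- BRIDGE TO THE TREE: under the tuple encoding, `GoodFour` is membership in the tree's `fiveStepIndex d` (no immediate reversal,
not a unit square). [cite: MadrasSlade1993, §4.2, eq. (4.2.20)–(4.2.22) (p. 94, 2013 reprint)] -/
theorem goodFour_tuple4Equiv_iff (d : ℕ) (t : Idx d × Idx d × Idx d × Idx d) :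
    GoodFour (tuple4Equiv d t) ↔ t ∈ fiveStepIndex d := by
  obtain ⟨a, b, c, e⟩ := t
  have h01 : ∑ p ∈ ({0, 1} : Finset (Fin 4)), twoStepV d (tuple4Equiv d (a, b, c, e) p) = twoStepV d a + twoStepV d b := by
    rw [Finset.sum_pair (by decide)]; rfl
  have h12 : ∑ p ∈ ({1, 2} : Finset (Fin 4)), twoStepV d (tuple4Equiv d (a, b, c, e) p) = twoStepV d b + twoStepV d c := by
    rw [Finset.sum_pair (by decide)]; rfl
  have h23 : ∑ p ∈ ({2, 3} : Finset (Fin 4)), twoStepV d (tuple4Equiv d (a, b, c, e) p) = twoStepV d c + twoStepV d e := by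
    rw [Finset.sum_pair (by decide)]; rfl
  have h0123 : ∑ p ∈ (Finset.univ : Finset (Fin 4)), twoStepV d (tuple4Equiv d (a, b, c, e) p) =
      twoStepV d a + twoStepV d b + twoStepV d c + twoStepV d e := by
    rw [Fin.sum_univ_four]; rfl
  unfold GoodFour
  rw [h01, h12, h23, h0123, fiveStepIndex, Finset.mem_filter, Ne, Ne, Ne, Ne, twoStepV_add_eq_zero_iff, twoStepV_add_eq_zero_iff,
    twoStepV_add_eq_zero_iff, ThreeSlackTwo.sum_four_eq_zero_iff]
  simp only [Finset.mem_univ, true_and]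
  constructor
  · rintro ⟨h1, h2, h3, h4⟩
    exact ⟨h1, h2, h3, fun hce => h4 (Or.inr (Or.inl hce))⟩
  · rintro ⟨h1, h2, h3, h4⟩
    refine ⟨h1, h2, h3, ?_⟩
    rintro (⟨hb, -⟩ | hce | ⟨-, hcb⟩)
    exacts [h1 hb, h4 hce, h2 hcb]

/-- The `GoodFour` count IS the tree's five-step index count. [cite: MadrasSlade1993, §4.2, eq. (4.2.20)–(4.2.22) (p. 94, 2013 reprint)] -/
theorem card_filter_goodFour (d : ℕ) :
    (Finset.univ.filter fun u : Word 4 d => GoodFour u).card = (fiveStepIndex d).card := by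
  rw [card_filter_univ_equiv (tuple4Equiv d)]
  congr 1
  ext t
  rw [Finset.mem_filter, goodFour_tuple4Equiv_iff]
  exact ⟨fun h => h.2, fun h => ⟨Finset.mem_univ _, h⟩⟩

/-- ★ THE TREE'S FIVE-STEP COUNT RE-DERIVED BY AXIS TYPES: `#fiveStepIndex d + 24d³ = 16d⁴ + 8d² + 2d` for every `d` (tree
`card_fiveStepIndex`: `2d(2d−1)³ − 2d(2d−2)`), here obtained through `card_filter_eq_sum_transversal` and the kernel enumeration of
the 240 types. [cite: MadrasSlade1993, §4.2, eq. (4.2.20)–(4.2.22) (p. 94, 2013 reprint)] -/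
theorem card_fiveStepIndex_by_types (d : ℕ) : (fiveStepIndex d).card + 24 * d ^ 3 = 16 * d ^ 4 + 8 * d ^ 2 + 2 * d := by
  rw [← card_filter_goodFour]
  exact card_goodFour d

end WordTypes

end Literature.Probability.RandomPlanarGeometry.SAW.Zd

end
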